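import Summits.QuantumFields.YangMills.Theorems.BalabanLadderIRcofEquipartitionSeamMixUnits
import HarnessLib

/-!
# Line `equipartition_seam` (crux `IRcof`, stmt-QuantumFields-26930) — stub S7 `MixUnits`: POINTER (rev 2)

Everything revision 1 of this workfile contained (crux write 11a4c1684aae; ideator `ym-ir-idea-22` g4; critic `ym-ir-crit-3` g4
TYPEREAD №2 CLEAN) is LANDED in `Theorems/` by the LEAD lane `ym-ir-line-ab-p1` g7 from this ideator's cuts:

| part | content | landed file | pid |
|---|---|---|---|
| U | §0–§1 of the skeleton VERBATIM: `Plane`, `Sector`, `Labelling`, `EquiUnitOn`, `EBlindUnitOn`, `PscUnitOn`, `BadUnitOn`, `CoverGapCof` + 3 sanity lemmas (ns `…Cruxes.IRcof.EquipartitionSeam`) | `BalabanLadderIRcofEquipartitionSeamUnitDefs` | p676630 |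
| M | ★ `Mix.mixUnits_text` = the statement of stub S7 `MixUnits` VERBATIM, proved (per-torus body of crux 16405's `mix_core` re-run above the thresholds, constants drawn before `β`) | `BalabanLadderIRcofEquipartitionSeamMixUnits` | p676879 |

CONSEQUENCE.  Stub S7 `MixUnits` of the registered skeleton `Lines/equipartition_seam.lean` is DISCHARGED BY NAME since its rev 6
(crux write 6763e14e8ba5, published by g5): `theorem mixUnits_holds : MixUnits := Mix.mixUnits_text`; the skeleton imports U and drops its
own §0–§1.  The check below re-asserts, against the landed module only, that the landed theorem has the statement of S7 character for
character (skeleton rev 6 l.237–251).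

HONEST LABEL.  The Yang–Mills mass gap (Clay) is NOT proved; `IRcof` ∕ `IR` 0 ∕ 1; S7 is the line's ROUTINE re-assembly stub (support
class) — closing it moves no wall (S3 `EquiUnits` ∕ S5ᵛ `PscUnitsCofV` untouched; census row 47 class PWP unchanged, mechanism 0);
nothing continuum ∕ OS ∕ Clay.
-/

set_option autoImplicit false

open Filter Topology MeasureTheory
open Literature.MathematicalPhysics.QuantumFieldTheory Literature.MathematicalPhysics.QuantumLattice
open Summit.QuantumFields.YangMills.Theorems.NonSimplyConnectedLatticeGap

namespace Summit.QuantumFields.YangMills.Cruxes.IRcof.EquipartitionSeam.Mix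

/-- Pointer check: the landed `Mix.mixUnits_text` has exactly the statement of stub S7 `MixUnits`
(`Lines/equipartition_seam.lean` rev 6 l.237–251, verbatim). -/
example :
    ∀ (G : Type) [Group G] [TopologicalSpace G] [IsTopologicalGroup G] [CompactSpace G] [MeasurableSpace G]
      [BorelSpace G], IsCompactSimpleLieGroup G → ∀ (H : Type) [Group H] [TopologicalSpace H] [IsTopologicalGroup H]
      [CompactSpace H] [MeasurableSpace H] [BorelSpace H], IsCompactSimpleLieGroup H → SimplyConnectedSpace H →
      ∀ (π : H →* G), Continuous π → Function.Surjective π → π.ker ≤ Subgroup.center H → (π.ker : Set H).Finite →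
      π.ker ≠ ⊥ → ∀ (ρH : LatticeRep H) (r : LatticeRep G) (au : ℝ → ℝ), (∀ β, 0 < au β) →
      Tendsto au atTop (𝓝 0) → ∀ (a : ℝ) (cls : Labelling π), (∀ S : ℕ, TwistSectorInterface π ρH r a S (cls S)) →
      (∃ (β_c C : ℝ) (S_c : ℝ → ℕ), ∀ β : ℝ, β_c ≤ β → BadUnitOn π r β cls (S_c β) C) →
      (∃ Bset : Set ℝ, (∀ x : ℝ, ∃ β ∈ Bset, x ≤ β) ∧ ∃ (c_p β_p : ℝ) (S_p : ℝ → ℕ), 0 < c_p ∧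
        ∀ A B : YMSpecies G, ∃ C : ℝ, ∀ β ∈ Bset, β_p ≤ β → PscUnitOn π r β cls (S_p β) A B C (c_p * au β)) →
      (∃ (β_e : ℝ) (S_e : ℝ → ℕ), ∀ β : ℝ, β_e ≤ β → EquiUnitOn π r β cls (S_e β)) →
      (∃ (β_b : ℝ) (S_b : ℝ → ℕ), ∀ A : YMSpecies G, ∃ C : ℝ, ∀ β : ℝ, β_b ≤ β →
        EBlindUnitOn π r β cls (S_b β) A C) →
        CoverGapCof π r au :=
  mixUnits_text

end Summit.QuantumFields.YangMills.Cruxes.IRcof.EquipartitionSeam.Mix
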